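import Summits.ValiantsHypothesis.ValiantsHypothesis.Theses.SliceSignRank
import Summits.ValiantsHypothesis.ValiantsHypothesis.Theorems.SliceSignRankSignRankLinearLowerElimination

/-!
# Route SliceSignRank — support item `SignRankLinearLower` (stmt-ValiantsHypothesis-15122), closed

`SignRankLinearLower`: there is an absolute `C` such that `n ≤ C·k` whenever `k` real twists
sign-represent `sgn` on `S_n` (`W_1, …, W_k ∈ ℝ^{n×n}` with `sgn(σ) Σ_t Π_i W_t(σ i, i) > 0` for
all `σ`). PROVED with `C = 3` (indeed `k ≥ ⌊n/3⌋ + 1`):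

* restrict to the block permutations `S_3^m ↪ S_n`, `m = ⌊n/3⌋` (the index set is read as
  `Fin m × Fin 3 ⊕ Fin r` through `finProdFinEquiv`/`finSumFinEquiv`, the permutation is
  `Equiv.permCongr` of `Perm.sumCongr (Equiv.prodCongrRight σ') 1`): each twist factors as
  `c_t · Π_j h_{t,j}(ρ_j)` with 3×3 slice functions `h_{t,j}` and `sgn` becomes `Π_j sgn ρ_j`
  (`Perm.sign_prodCongrRight`);
* every slice function is admissible by Pólya on `S_3` (`slice_admissible`), so the rank-one
  elimination (`elimination`, both in `SliceSignRankSignRankLinearLowerElimination.lean`) gives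
  `m + 1 ≤ k`, whence `n ≤ 3m + 2 < 3k`.

* `signRankLinearLower_proof : SignRankLinearLower` — the item, verbatim.

Honest framing: the route's first-rung linear lower bound for the slice sign-rank of `sgn`
(the card's Theorem A; the crux `SignRankSuperQP` asks for super-quasi-polynomial growth and is
untouched); nothing here bears on VP ≠ VNP.
-/

set_option linter.dupNamespace false

noncomputable section

namespace Summit.ValiantsHypothesis.ValiantsHypothesis.Theorems.SliceSignRank

open Equiv Finset

/-- **Item `SignRankLinearLower` (stmt-ValiantsHypothesis-15122), with `C = 3`.** If `k` real twists
sign-represent `sgn` on `S_n` then `n ≤ 3k`: block restriction to `S_3^{⌊n/3⌋}`, Pólya on each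
`3 × 3` block, rank-one elimination. [folklore] -/
theorem signRankLinearLower_proof : Theses.SliceSignRank.SignRankLinearLower := by
  classical
  refine ⟨3, fun n k hW => ?_⟩
  obtain ⟨W, hW⟩ := hW
  -- `n = m * 3 + r`, `r < 3`
  obtain ⟨m, r, hr, hn⟩ : ∃ m r : ℕ, r < 3 ∧ m * 3 + r = n :=
    ⟨n / 3, n % 3, Nat.mod_lt _ (by norm_num), by rw [mul_comm]; exact Nat.div_add_mod n 3⟩
  subst hn
  -- the block decomposition of the index set
  let e : (Fin m × Fin 3) ⊕ Fin r ≃ Fin (m * 3 + r) :=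
    (Equiv.sumCongr finProdFinEquiv (Equiv.refl (Fin r))).trans finSumFinEquiv
  let M : Fin k → Fin m → Matrix (Fin 3) (Fin 3) ℝ :=
    fun t j x a => W t (e (Sum.inl (j, x))) (e (Sum.inl (j, a)))
  let cst : Fin k → ℝ := fun t => ∏ i : Fin r, W t (e (Sum.inr i)) (e (Sum.inr i))
  -- rank-one elimination over the block permutations
  have key := elimination m (Finset.univ : Finset (Fin k)) cst
    (fun t j ρ => ∏ a, M t j (ρ a) a) 1 (Or.inl rfl) (fun t _ j => slice_admissible (M t j)) ?_
  · rw [Finset.card_univ, Fintype.card_fin] at key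
    omega
  -- positivity at the block permutation built from `σ' ∈ S_3^m`
  intro σ'
  let p : Perm ((Fin m × Fin 3) ⊕ Fin r) :=
    Equiv.Perm.sumCongr (Equiv.prodCongrRight σ') (Equiv.refl (Fin r))
  have hσ := hW (e.permCongr p)
  -- its sign
  have hsign : ((Perm.sign (e.permCongr p) : ℤ) : ℝ) = ∏ j, ((Perm.sign (σ' j) : ℤ) : ℝ) := by
    rw [Perm.sign_permCongr]
    change ((Perm.sign (Equiv.Perm.sumCongr (Equiv.prodCongrRight σ') (1 : Perm (Fin r))) : ℤ) : ℝ)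
      = _
    rw [Perm.sign_sumCongr, Perm.sign_prodCongrRight, Perm.sign_one, mul_one, Units.coe_prod,
      Int.cast_prod]
  -- its twisted products
  have hprod : ∀ t : Fin k, ∏ i, W t ((e.permCongr p) i) i =
      (∏ j, ∏ a, M t j ((σ' j) a) a) * cst t := by
    intro t
    rw [← Equiv.prod_comp e (fun i => W t ((e.permCongr p) i) i)]
    simp only [Equiv.permCongr_apply, Equiv.symm_apply_apply]
    rw [Fintype.prod_sum_type, Fintype.prod_prod_type]
    rfl
  rw [hsign] at hσ
  simp_rw [hprod] at hσ
  have hcomm : ∑ t, (∏ j, ∏ a, M t j ((σ' j) a) a) * cst t =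
      ∑ t ∈ (Finset.univ : Finset (Fin k)), cst t * ∏ j, ∏ a, M t j ((σ' j) a) a :=
    Finset.sum_congr rfl fun t _ => mul_comm _ _
  rw [hcomm] at hσ
  rw [one_mul]
  exact hσ

end Summit.ValiantsHypothesis.ValiantsHypothesis.Theorems.SliceSignRank
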